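import Summits.AtomisticToContinuum.HydrodynamicLimit.Theorems.CollisionIsometryCLTAdaptedWeightCLTBHContactToMassHellinger
import Summits.AtomisticToContinuum.HydrodynamicLimit.Theorems.CollisionIsometryCLTAdaptedWeightCLTBHEEPClosureFlux
import Literature.MathematicalPhysics.KineticTheory.HardSphereCrossSection
import Mathlib.MeasureTheory.Measure.Lebesgue.VolumeOfBalls

/-!
# Stub `stub_contactToMass` (S4) of the line `block-h-dissipation-closure`, helper file 10: a UNIFORM LOWER BOUND ON
THE FLUX of the regularised cell law
(crux `CollisionIsometryCLT.AdaptedWeightCLT`, stmt-AtomisticToContinuum-14868; `--supports`, anchor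
`bhContactToMass_fluxLower_anchor`)

The denominator of the real-form modulus (`…BHContactToMassModulusReal.hellDiss_sub_le`) is the flux `Z(f₁)` of
the law whose dissipation is bounded from above; for the charging argument of `stub_contactToMass` it must be bounded
BELOW uniformly in the cell, the configuration and `N`. It is, at fixed regularisation `(h, δ)`:
* `fluxZ_eq_pi_integral` — `Z(f) = π ∫∫ |v − w| f(v) f(w) dv dw` (the sphere integral of the hard-sphere kernel is
  `π|v − w|`, tree `integral_hardSphereKernel_eq_pi_mul_norm`; Fubini over `dv dv_* dω`);
* `fluxZ_mono`, `fluxZ_const_mul` — `Z` is monotone on nonnegative laws and `Z(c f) = c² Z(f)`;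
* `fluxZ_localMaxwellian_ge` — `Z(M_{1,θ,u}) ≥ π h/2` for `θ ≥ h²`: `|v − w| ≥ h(1 − 𝟙{|v−w|<h})`, `∫∫ M⊗M = 1`, and
  `∫∫_{|v−w|<h} M⊗M ≤ sup M · |B_h| ≤ (2πh²)^{-3/2} (4π/3) h³ = 2/(3√(2π)) ≤ 1/2` (`EntropyBudget.lM_le_gMax`,
  `EuclideanSpace.volume_ball_fin_three`);
* `fluxZ_cellLaw_ge` — **`Z(f̂_x) ≥ δ² h`** for every nonnegative kernel family, `0 < h`, `0 ≤ δ ≤ 1`, every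
  configuration and location (`f̂ ≥ δ M_{1,θ̄+h²,ū}`, `θ̄ + h² ≥ h²`), with the integrability of `B f̂ f̂_*`
  (`integrable_kernel_cellLaw`, sixth moments of the Gaussian mixture) and `Z(f̂_x) > 0` for `δ > 0` (`fluxZ_cellLaw_pos`).
-/

namespace Summit.AtomisticToContinuum.HydrodynamicLimit.Theorems.BlockHDissipation

open scoped BigOperators Topology Classical MeasureTheory ENNReal InnerProductSpace
open Filter Set MeasureTheory
open Literature.Analysis.FluidPDE
open Summit.AtomisticToContinuum.HydrodynamicLimit.Theorems.ContactSourceDuhamel (T3 V3 Cfg Vel Flow Flows)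
open Literature.MathematicalPhysics.KineticTheory (collide hardSphereKernel sphereMeasure localMaxwellian_nonneg
  continuous_localMaxwellian integral_localMaxwellian_one integrable_localMaxwellian
  integral_hardSphereKernel_eq_pi_mul_norm)

noncomputable section

namespace ContactToMass

variable {f g : V3 → ℝ}

/-! ## The flux as a pair integral -/

/-- **`Z(f) = π ∫∫ |v − w| f(v) f(w) dv dw`** when `B f f_*` is integrable on pair space. -/
theorem fluxZ_eq_pi_integral
    (hint : Integrable (fun q : PairDir => hardSphereKernel q.1 q.2 * (f q.1.1 * f q.1.2)) pairDirMeasure) :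
    fluxZ f = Real.pi * ∫ p : V3 × V3, ‖p.1 - p.2‖ * (f p.1 * f p.2) ∂((volume : Measure V3).prod volume) := by
  haveI := isFiniteMeasure_sphereMeasure (E := V3)
  unfold fluxZ
  rw [DVTransfer.pairDirMeasure_eq] at hint ⊢
  rw [integral_prod _ hint]
  have hin : (fun p : V3 × V3 => ∫ ω, hardSphereKernel (p, ω).1 (p, ω).2 * (f (p, ω).1.1 * f (p, ω).1.2) ∂sphereMeasure) =
      fun p : V3 × V3 => Real.pi * (‖p.1 - p.2‖ * (f p.1 * f p.2)) := by
    funext p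
    obtain ⟨v, w⟩ := p
    simp only []
    rw [integral_mul_const, integral_hardSphereKernel_eq_pi_mul_norm]
    ring
  rw [hin, integral_const_mul]

/-- `Z` is monotone on nonnegative laws (both flux integrands integrable). -/
theorem fluxZ_mono (hg0 : ∀ v, 0 ≤ g v) (hfg : ∀ v, g v ≤ f v)
    (hint_g : Integrable (fun q : PairDir => hardSphereKernel q.1 q.2 * (g q.1.1 * g q.1.2)) pairDirMeasure)
    (hint_f : Integrable (fun q : PairDir => hardSphereKernel q.1 q.2 * (f q.1.1 * f q.1.2)) pairDirMeasure) :
    fluxZ g ≤ fluxZ f :=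
  integral_mono hint_g hint_f fun _ => mul_le_mul_of_nonneg_left
    (mul_le_mul (hfg _) (hfg _) (hg0 _) ((hg0 _).trans (hfg _))) (le_max_right _ _)

/-- `Z(c f) = c² Z(f)`. -/
theorem fluxZ_const_mul (c : ℝ) (f : V3 → ℝ) : fluxZ (fun v => c * f v) = c ^ 2 * fluxZ f := by
  unfold fluxZ
  rw [← integral_const_mul]
  congr 1
  funext q
  ring

/-! ## The Maxwellian lower bound -/

section Maxw

variable {θ h : ℝ}

/-- `B M M_*` is integrable for a Maxwellian (`θ > 0`). -/
theorem integrable_kernel_localMaxwellian (hθ : 0 < θ) (u : V3) :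
    Integrable (fun q : PairDir => hardSphereKernel q.1 q.2 *
      (localMaxwellian 1 θ u q.1.1 * localMaxwellian 1 θ u q.1.2)) pairDirMeasure :=
  EEP.integrable_kernel_mul_pair_of_cube (continuous_localMaxwellian 1 θ u)
    (fun v => localMaxwellian_nonneg zero_le_one hθ.le u v)
    (EEP.integrable_localMaxwellian_mul_of_le hθ u EEP.continuous_one_add_norm_sq_cube (C := 1) (k := 6) fun w => by
      rw [abs_of_nonneg (by positivity), one_mul]; exact EEP.one_add_norm_sq_cube_le w)

/-- The numerical constant: `(2πh²)^{-3/2} · (4π/3) h³ = 2/(3√(2π)) ≤ 1/2`. -/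
theorem gMax_mul_ball_le (hh : 0 < h) :
    (2 * Real.pi * h ^ 2) ^ (-(3 : ℝ) / 2) * (Real.pi * 4 / 3 * h ^ 3) ≤ 1 / 2 := by
  have hπ : 0 < Real.pi := Real.pi_pos
  have hs : 2 ≤ Real.sqrt (2 * Real.pi) := by
    have h4 : (2 : ℝ) = Real.sqrt 4 := by
      rw [show (4 : ℝ) = 2 ^ 2 by norm_num, Real.sqrt_sq (by norm_num)]
    rw [h4]
    exact Real.sqrt_le_sqrt (by nlinarith [Real.pi_gt_three])
  have e1 : (2 * Real.pi * h ^ 2) ^ ((3 : ℝ) / 2) = 2 * Real.pi * h ^ 2 * (Real.sqrt (2 * Real.pi) * h) := by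
    rw [show (3 : ℝ) / 2 = 1 + 1 / 2 by norm_num, Real.rpow_add (by positivity), Real.rpow_one, ← Real.sqrt_eq_rpow,
      Real.sqrt_mul (by positivity) (h ^ 2), Real.sqrt_sq hh.le]
  have e2 : (2 * Real.pi * h ^ 2) ^ (-(3 : ℝ) / 2) = ((2 * Real.pi * h ^ 2) ^ ((3 : ℝ) / 2))⁻¹ := by
    rw [show (-(3 : ℝ) / 2) = -((3 : ℝ) / 2) by ring, Real.rpow_neg (by positivity)]
  rw [e2, e1, inv_mul_eq_div, div_le_iff₀ (by positivity)]
  have hph : 0 < Real.pi * h ^ 3 := by positivity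
  nlinarith [mul_le_mul_of_nonneg_left hs hph.le]

/-- **`Z(M_{1,θ,u}) ≥ π h / 2`** for `0 < h`, `h² ≤ θ`. -/
theorem fluxZ_localMaxwellian_ge (hh : 0 < h) (hθ : h ^ 2 ≤ θ) (u : V3) :
    Real.pi * h / 2 ≤ fluxZ (localMaxwellian 1 θ u) := by
  set M : V3 → ℝ := localMaxwellian 1 θ u with hM
  have hθ0 : 0 < θ := lt_of_lt_of_le (pow_pos hh 2) hθ
  have hM0 : ∀ v, 0 ≤ M v := fun v => localMaxwellian_nonneg zero_le_one hθ0.le u v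
  have hMc : Continuous M := continuous_localMaxwellian 1 θ u
  have hMi : Integrable M := integrable_localMaxwellian hθ0 u
  have hM1 : ∫ v, M v = 1 := integral_localMaxwellian_one hθ0 u
  have hMle : ∀ v, M v ≤ (2 * Real.pi * h ^ 2) ^ (-(3 : ℝ) / 2) := fun v => EntropyBudget.lM_le_gMax hh hθ u v
  have hM1i : Integrable fun w => M w * (1 + ‖w‖) :=
    EEP.integrable_localMaxwellian_mul_of_le hθ0 u (by fun_prop) (C := 1) (k := 1) fun w => by
      rw [abs_of_nonneg (by positivity), one_mul, pow_one]
  rw [fluxZ_eq_pi_integral (integrable_kernel_localMaxwellian hθ0 u)]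
  -- the near-diagonal set and the pair integrals
  set S : Set (V3 × V3) := {p | ‖p.1 - p.2‖ < h} with hS
  have hSm : MeasurableSet S := measurableSet_lt (measurable_fst.sub measurable_snd).norm measurable_const
  have hMM : Integrable (fun p : V3 × V3 => M p.1 * M p.2) ((volume : Measure V3).prod volume) := hMi.mul_prod hMi
  have hJ : Integrable (S.indicator fun p : V3 × V3 => M p.1 * M p.2) ((volume : Measure V3).prod volume) :=
    hMM.indicator hSm
  have hMM1 : ∫ p : V3 × V3, M p.1 * M p.2 ∂((volume : Measure V3).prod volume) = 1 := by
    rw [integral_prod_mul, hM1, mul_one]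
  -- `J = ∫∫_{|v−w|<h} M⊗M ≤ 1/2`
  set c : ℝ := (2 * Real.pi * h ^ 2) ^ (-(3 : ℝ) / 2) with hc
  have hc0 : 0 ≤ c := Real.rpow_nonneg (by positivity) _
  have hball : ∀ v : V3, (volume : Measure V3).real (Metric.ball v h) = Real.pi * 4 / 3 * h ^ 3 := by
    intro v
    rw [Measure.real, EuclideanSpace.volume_ball_fin_three, ENNReal.toReal_mul, ← ENNReal.ofReal_pow hh.le,
      ENNReal.toReal_ofReal (by positivity), ENNReal.toReal_ofReal (by positivity)]
    ring
  have hinner : ∀ v : V3, ∫ w, S.indicator (fun p : V3 × V3 => M p.1 * M p.2) (v, w) ≤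
      M v * (c * (Real.pi * 4 / 3 * h ^ 3)) := by
    intro v
    have hind : (fun w => S.indicator (fun p : V3 × V3 => M p.1 * M p.2) (v, w)) =
        (Metric.ball v h).indicator fun w => M v * M w := by
      funext w
      by_cases hw : w ∈ Metric.ball v h
      · have hvw : (v, w) ∈ S := by
          rw [Metric.mem_ball, dist_eq_norm] at hw
          show ‖v - w‖ < h
          rwa [norm_sub_rev]
        rw [indicator_of_mem hvw, indicator_of_mem hw]
      · have hvw : (v, w) ∉ S := by
          intro hvw
          apply hw
          rw [Metric.mem_ball, dist_eq_norm, norm_sub_rev]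
          exact hvw
        rw [indicator_of_notMem hvw, indicator_of_notMem hw]
    rw [hind, integral_indicator Metric.isOpen_ball.measurableSet]
    have hfin : (volume : Measure V3) (Metric.ball v h) < ⊤ := by
      rw [EuclideanSpace.volume_ball_fin_three]
      exact ENNReal.mul_lt_top (ENNReal.pow_lt_top ENNReal.ofReal_lt_top) ENNReal.ofReal_lt_top
    have hbound := norm_setIntegral_le_of_norm_le_const (μ := (volume : Measure V3)) (s := Metric.ball v h)
      (f := fun w => M v * M w) (C := M v * c) hfin fun w _ => by
        rw [Real.norm_eq_abs, abs_of_nonneg (mul_nonneg (hM0 v) (hM0 w))]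
        exact mul_le_mul_of_nonneg_left (hMle w) (hM0 v)
    rw [hball v] at hbound
    calc ∫ w in Metric.ball v h, M v * M w ≤ ‖∫ w in Metric.ball v h, M v * M w‖ := Real.le_norm_self _
      _ ≤ M v * c * (Real.pi * 4 / 3 * h ^ 3) := hbound
      _ = _ := by ring
  have hJle : ∫ p, S.indicator (fun p : V3 × V3 => M p.1 * M p.2) p ∂((volume : Measure V3).prod volume) ≤ 1 / 2 := by
    rw [integral_prod _ hJ]
    calc ∫ v, ∫ w, S.indicator (fun p : V3 × V3 => M p.1 * M p.2) (v, w)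
        ≤ ∫ v, M v * (c * (Real.pi * 4 / 3 * h ^ 3)) :=
          integral_mono_of_nonneg (ae_of_all _ fun v => integral_nonneg fun w =>
            Set.indicator_nonneg (fun p _ => mul_nonneg (hM0 p.1) (hM0 p.2)) _) (hMi.mul_const _) (ae_of_all _ hinner)
      _ = c * (Real.pi * 4 / 3 * h ^ 3) := by rw [integral_mul_const, hM1, one_mul]
      _ ≤ 1 / 2 := gMax_mul_ball_le hh
  -- pointwise: `h M⊗M − h 𝟙_S M⊗M ≤ |v − w| M⊗M`
  have hpt : ∀ p : V3 × V3, h * (M p.1 * M p.2) - h * S.indicator (fun p : V3 × V3 => M p.1 * M p.2) p ≤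
      ‖p.1 - p.2‖ * (M p.1 * M p.2) := by
    intro p
    have hmm : 0 ≤ M p.1 * M p.2 := mul_nonneg (hM0 _) (hM0 _)
    by_cases hp : p ∈ S
    · rw [indicator_of_mem hp]
      have := mul_nonneg (norm_nonneg (p.1 - p.2)) hmm
      linarith
    · rw [indicator_of_notMem hp, mul_zero, sub_zero]
      have hge : h ≤ ‖p.1 - p.2‖ := not_lt.1 hp
      exact mul_le_mul_of_nonneg_right hge hmm
  -- integrability of `|v − w| M⊗M`
  have hFi : Integrable (fun p : V3 × V3 => ‖p.1 - p.2‖ * (M p.1 * M p.2)) ((volume : Measure V3).prod volume) := by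
    have hdom : Integrable (fun p : V3 × V3 => (M p.1 * (1 + ‖p.1‖)) * (M p.2 * (1 + ‖p.2‖)))
        ((volume : Measure V3).prod volume) := hM1i.mul_prod hM1i
    refine hdom.mono' ?_ (ae_of_all _ fun p => ?_)
    · exact ((measurable_fst.sub measurable_snd).norm.mul ((hMc.measurable.comp measurable_fst).mul
        (hMc.measurable.comp measurable_snd))).aestronglyMeasurable
    · have hmm : 0 ≤ M p.1 * M p.2 := mul_nonneg (hM0 _) (hM0 _)
      rw [Real.norm_eq_abs, abs_of_nonneg (mul_nonneg (norm_nonneg _) hmm)]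
      have h1 : ‖p.1 - p.2‖ ≤ (1 + ‖p.1‖) * (1 + ‖p.2‖) := by
        nlinarith [norm_sub_le p.1 p.2, norm_nonneg p.1, norm_nonneg p.2, mul_nonneg (norm_nonneg p.1) (norm_nonneg p.2)]
      calc ‖p.1 - p.2‖ * (M p.1 * M p.2) ≤ (1 + ‖p.1‖) * (1 + ‖p.2‖) * (M p.1 * M p.2) :=
            mul_le_mul_of_nonneg_right h1 hmm
        _ = _ := by ring
  have hlow : h * 1 - h * (1 / 2) ≤ ∫ p : V3 × V3, ‖p.1 - p.2‖ * (M p.1 * M p.2) ∂((volume : Measure V3).prod volume) := by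
    calc h * 1 - h * (1 / 2)
        ≤ h * (∫ p : V3 × V3, M p.1 * M p.2 ∂((volume : Measure V3).prod volume)) -
            h * ∫ p, S.indicator (fun p : V3 × V3 => M p.1 * M p.2) p ∂((volume : Measure V3).prod volume) := by
          rw [hMM1]
          nlinarith [hJle, hh]
      _ = ∫ p : V3 × V3, (h * (M p.1 * M p.2) - h * S.indicator (fun p : V3 × V3 => M p.1 * M p.2) p)
            ∂((volume : Measure V3).prod volume) := by
          rw [integral_sub (hMM.const_mul h) (hJ.const_mul h), integral_const_mul, integral_const_mul]
      _ ≤ _ := integral_mono ((hMM.const_mul h).sub (hJ.const_mul h)) hFi hpt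
  have hπ : 0 < Real.pi := Real.pi_pos
  nlinarith [hlow, hπ]

end Maxw

/-! ## The regularised cell law -/

section Cell

variable {N : ℕ} {ψ : ℕ → T3 → ℝ} (hψ : ∀ N y, 0 ≤ ψ N y) {h : ℝ}
include hψ

/-- The sixth moment of the regularised cell law is integrable (`h > 0`). -/
theorem integrable_cellLaw_mul_cube (hh : 0 < h) (δ : ℝ) (w : Cfg N) (x : T3) :
    Integrable fun v => cellLaw N ψ h δ w x v * (1 + ‖v‖ ^ 2) ^ 3 := by
  have hle : ∀ v : V3, |(1 + ‖v‖ ^ 2) ^ 3| ≤ 1 * (1 + ‖v‖) ^ 6 := fun v => by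
    rw [abs_of_nonneg (by positivity), one_mul]; exact EEP.one_add_norm_sq_cube_le v
  have hG : ∀ i : Fin (N + 1), Integrable fun v => gauss h (w i).2 v * (1 + ‖v‖ ^ 2) ^ 3 := fun i =>
    EEP.integrable_gauss_mul_of_le hh _ EEP.continuous_one_add_norm_sq_cube hle
  have hθ0 : 0 < cT N ψ w x + h ^ 2 := add_pos_of_nonneg_of_pos (cT_nonneg hψ w x) (pow_pos hh 2)
  have hMx : Integrable fun v => localMaxwellian 1 (cT N ψ w x + h ^ 2) (cU N ψ w x) v * (1 + ‖v‖ ^ 2) ^ 3 :=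
    EEP.integrable_localMaxwellian_mul_of_le hθ0 _ EEP.continuous_one_add_norm_sq_cube hle
  have hK : Integrable fun v => kde N ψ h w x v * (1 + ‖v‖ ^ 2) ^ 3 := by
    have e : (fun v => kde N ψ h w x v * (1 + ‖v‖ ^ 2) ^ 3) =
        fun v => (cW N ψ w x)⁻¹ * ∑ i, cw N ψ w x i * (gauss h (w i).2 v * (1 + ‖v‖ ^ 2) ^ 3) := by
      funext v
      simp only [kde]
      rw [mul_assoc, Finset.sum_mul]
      refine congrArg _ (Finset.sum_congr rfl fun i _ => ?_)
      ring
    rw [e]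
    exact (integrable_finsetSum _ fun i _ => (hG i).const_mul _).const_mul _
  have e : (fun v => cellLaw N ψ h δ w x v * (1 + ‖v‖ ^ 2) ^ 3) =
      fun v => (1 - δ) * (kde N ψ h w x v * (1 + ‖v‖ ^ 2) ^ 3) +
        δ * (localMaxwellian 1 (cT N ψ w x + h ^ 2) (cU N ψ w x) v * (1 + ‖v‖ ^ 2) ^ 3) := by
    funext v
    simp only [cellLaw]
    ring
  rw [e]
  exact (hK.const_mul _).add (hMx.const_mul _)

/-- **`B f̂ f̂_*` is integrable** for the regularised cell law (`h > 0`, `0 ≤ δ ≤ 1`). -/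
theorem integrable_kernel_cellLaw (hh : 0 < h) {δ : ℝ} (hδ0 : 0 ≤ δ) (hδ1 : δ ≤ 1) (w : Cfg N) (x : T3) :
    Integrable (fun q : PairDir => hardSphereKernel q.1 q.2 *
      (cellLaw N ψ h δ w x q.1.1 * cellLaw N ψ h δ w x q.1.2)) pairDirMeasure :=
  EEP.integrable_kernel_mul_pair_of_cube (continuous_cellLaw h δ w x) (cellLaw_nonneg hψ hδ0 hδ1 h w x)
    (integrable_cellLaw_mul_cube hψ hh δ w x)

/-- **UNIFORM FLUX LOWER BOUND: `Z(f̂_x) ≥ δ² h`** for a nonnegative kernel family, `0 < h`, `0 ≤ δ ≤ 1`, every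
configuration and every location. -/
theorem fluxZ_cellLaw_ge (hh : 0 < h) {δ : ℝ} (hδ0 : 0 ≤ δ) (hδ1 : δ ≤ 1) (w : Cfg N) (x : T3) :
    δ ^ 2 * h ≤ fluxZ (cellLaw N ψ h δ w x) := by
  set θ : ℝ := cT N ψ w x + h ^ 2 with hθdef
  have hθ : h ^ 2 ≤ θ := le_add_of_nonneg_left (cT_nonneg hψ w x)
  have hθ0 : 0 < θ := lt_of_lt_of_le (pow_pos hh 2) hθ
  set M : V3 → ℝ := localMaxwellian 1 θ (cU N ψ w x) with hMdef
  have hM0 : ∀ v, 0 ≤ M v := fun v => localMaxwellian_nonneg zero_le_one hθ0.le _ v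
  have hfloor : ∀ v, δ * M v ≤ cellLaw N ψ h δ w x v := fun v => floor_le_cellLaw hψ hδ1 h w x v
  have hintM := integrable_kernel_localMaxwellian hθ0 (cU N ψ w x)
  have hintδM : Integrable (fun q : PairDir => hardSphereKernel q.1 q.2 * ((δ * M q.1.1) * (δ * M q.1.2))) pairDirMeasure := by
    refine (hintM.const_mul (δ ^ 2)).congr (ae_of_all _ fun q => ?_)
    simp only [hMdef]
    ring
  have h1 : fluxZ (fun v => δ * M v) ≤ fluxZ (cellLaw N ψ h δ w x) :=
    fluxZ_mono (fun v => mul_nonneg hδ0 (hM0 v)) hfloor hintδM (integrable_kernel_cellLaw hψ hh hδ0 hδ1 w x)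
  have h2 : fluxZ (fun v => δ * M v) = δ ^ 2 * fluxZ M := fluxZ_const_mul δ M
  have h3 : Real.pi * h / 2 ≤ fluxZ M := fluxZ_localMaxwellian_ge hh hθ (cU N ψ w x)
  calc δ ^ 2 * h ≤ δ ^ 2 * (Real.pi * h / 2) :=
        mul_le_mul_of_nonneg_left (by nlinarith [Real.pi_gt_three, hh]) (sq_nonneg δ)
    _ ≤ δ ^ 2 * fluxZ M := mul_le_mul_of_nonneg_left h3 (sq_nonneg δ)
    _ = fluxZ (fun v => δ * M v) := h2.symm
    _ ≤ _ := h1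

/-- The flux of the regularised cell law is positive for `δ > 0`. -/
theorem fluxZ_cellLaw_pos (hh : 0 < h) {δ : ℝ} (hδ0 : 0 < δ) (hδ1 : δ ≤ 1) (w : Cfg N) (x : T3) :
    0 < fluxZ (cellLaw N ψ h δ w x) :=
  lt_of_lt_of_le (by positivity) (fluxZ_cellLaw_ge hψ hh hδ0.le hδ1 w x)

end Cell

end ContactToMass

/-- Registration anchor of this helper file (`--supports stmt-AtomisticToContinuum-14868`, stub
`stub_contactToMass`, file 10): the uniform flux lower bound `Z(f̂_x) ≥ δ² h` of the regularised cell law — the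
`∀`-closed form of `ContactToMass.fluxZ_cellLaw_ge`. -/
theorem bhContactToMass_fluxLower_anchor : ∀ (N : ℕ) (ψ : ℕ → T3 → ℝ), (∀ N y, 0 ≤ ψ N y) → ∀ h : ℝ, 0 < h →
    ∀ δ : ℝ, 0 ≤ δ → δ ≤ 1 → ∀ (w : Cfg N) (x : T3), δ ^ 2 * h ≤ fluxZ (cellLaw N ψ h δ w x) :=
  fun _ _ hψ _ hh _ hδ0 hδ1 w x => ContactToMass.fluxZ_cellLaw_ge hψ hh hδ0 hδ1 w x

end

end Summit.AtomisticToContinuum.HydrodynamicLimit.Theorems.BlockHDissipation
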